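import Summits.QuantumFields.YangMills.Theorems.UnitScaleTiltFluctuationComparisonRegPrAnsatzT1D

/-!
# Route `UnitScaleTilt` — crux K1bR-pr `FluctuationComparisonRegPrL` (stmt-QuantumFields-19935, ex 19201), stub `stub_oneStepSmallLift`
# (W7 line), (L1)-table for the INTERIOR (all-`L`) pipeline: «ANSATZ T» part 1b — THE FOUR CHAIN IDENTITIES AT KERNEL LEVEL, NEUTRALITY
# OF THE HOMOTOPY, AND CRUDE `ℓ¹` BOUNDS (support file `--supports stmt-QuantumFields-19935`)

Cell `ym3-torus` (rung R3), seat `ym3-torus-p2` gen 10 (IR-NODE §16).  Continues `…AnsatzT1D` (constants, the five 1-D kernels by components,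
`mk3`/`fδ`/`cΔ`, and the componentwise identities `I1a`–`I3g`).

* §1 **`fδ h = J¹ − P¹`**, **`cΔ h = J⁰ − P⁰`**, **`fδ J⁰ = cΔ J¹`**, **`fδ P⁰ = cΔ P¹`** (block size `L = 2h+1`, `h ≥ 1`, offsets `p ≤ 2h`, all `j`);
* §2 `Σ_{p ≤ 2h} b(p) = c₀(h+1)²` (block sum `L`), **`Σ_{p ≤ 2h} h(p, j) = 0`** (`S₀h = 0`: the transverse block sum kills the homotopy);
* §3 `‖P⁰‖, ‖P¹‖ ≤ 1`, `‖h‖ ≤ 1`, `‖J⁰‖ ≤ 2`, `‖J¹‖ ≤ 3/L` (componentwise absolute values; enough for the gain `λ ≤ 18/L²`).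

Elementary; nothing of Bałaban's is asserted.
-/

noncomputable section

namespace Summit.QuantumFields.YangMills.Theorems.ApproxLift.AnsatzT

section Identities

variable {h p : ℕ}

/-! ## §1 The four identities at the level of kernels -/

/-- **`J¹ − P¹ = ∂h`**: `fδ h = J¹ − P¹` (block size `L = 2h+1`, `h ≥ 1`, offsets `p ≤ 2h`, every `j`). -/
theorem fδ_hh (h1 : 1 ≤ h) (hp : p ≤ 2 * h) (j : ℤ) : fδ (2 * h + 1) (hh h) p j = J1 h p j - P1 h p j := by
  unfold hh J1 P1
  by_cases hlt : p < 2 * h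
  · rw [fδ_mk3_of_lt (by omega)]; unfold mk3
    have hP : P1z h p = 0 := by unfold P1z; rw [if_neg (by omega)]
    have hQ : J1p h p = 0 := by unfold J1p; rw [if_neg (by omega)]
    split_ifs <;> simp only [I1a hlt, I1b h1 hlt, hP, hQ, sub_zero, sub_self]
  · have hpe : p = 2 * h := by omega
    subst hpe
    rw [fδ_mk3_last (by omega)]; unfold mk3
    have hP : P1z h (2 * h) = 1 := by unfold P1z; rw [if_pos rfl]
    split_ifs <;> simp only [I1c, I1d h1, I1e, hP, sub_zero, sub_self]

/-- **`J⁰ − P⁰ = h∂`**: `cΔ h = J⁰ − P⁰` (every `p`, every `j`). -/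
theorem cΔ_hh (j : ℤ) : cΔ (hh h) p j = J0 h p j - P0 h p j := by
  unfold hh J0 P0
  rw [cΔ_mk3]; unfold mk3 P0z
  split_ifs <;> simp only [I2a, I2b, I2c, sub_zero, sub_self]

/-- **`∂J⁰ = J¹∂`**: `fδ J⁰ = cΔ J¹` (`h ≥ 1`, `p ≤ 2h`, every `j`). -/
theorem fδ_J0 (h1 : 1 ≤ h) (hp : p ≤ 2 * h) (j : ℤ) : fδ (2 * h + 1) (J0 h) p j = cΔ (J1 h) p j := by
  unfold J0 J1
  rw [cΔ_mk3]
  by_cases hlt : p < 2 * h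
  · rw [fδ_mk3_of_lt (by omega)]; unfold mk3
    have hQ : J1p h p = 0 := by unfold J1p; rw [if_neg (by omega)]
    split_ifs <;> simp only [I3a hlt, I3b h1 hlt, I3c h1 hlt, hQ, sub_zero]
  · have hpe : p = 2 * h := by omega
    subst hpe
    rw [fδ_mk3_last (by omega)]
    split_ifs <;> simp only [I3d, I3e h1, I3f h1, I3g h1]

/-- **`∂P⁰ = P¹∂`**: `fδ P⁰ = cΔ P¹` (`h ≥ 1`, `p ≤ 2h`, every `j`). -/
theorem fδ_P0 (h1 : 1 ≤ h) (hp : p ≤ 2 * h) (j : ℤ) : fδ (2 * h + 1) (P0 h) p j = cΔ (P1 h) p j := by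
  unfold P0 P1
  rw [cΔ_mk3]
  by_cases hlt : p < 2 * h
  · rw [fδ_mk3_of_lt (by omega)]; unfold mk3 P0z P1z
    have c : ¬ (p = 2 * h) := by omega
    split_ifs <;> simp
  · have hpe : p = 2 * h := by omega
    subst hpe
    rw [fδ_mk3_last (by omega)]; unfold P0z P1z
    simp

end Identities

/-! ## §2–§3 Neutrality of the homotopy and crude `ℓ¹` bounds -/

section Bounds

variable {h p : ℕ}

/-- `ε·b(p) ≤ h/(2L)` for `p ≤ 2h`. -/
theorem eps_bump_le' (hp : p ≤ 2 * h) : eps h * bump h p ≤ (h : ℝ) / (2 * Lr h) := by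
  obtain ⟨b0, b1⟩ := bump_bounds hp
  have he := eps_nonneg h
  have h1 : eps h * bump h p ≤ eps h * c0 h * ((h : ℝ) + 1) := by nlinarith
  have h2 : eps h * c0 h * ((h : ℝ) + 1) = (h : ℝ) / (2 * Lr h) := by
    rw [eps_mul_c0]; have := Lr_pos h; have : (0:ℝ) < (h:ℝ) + 1 := by positivity
    field_simp
  linarith

/-- The block sum of the bump is `L`: `Σ_{p ≤ 2h} b(p) = c₀ (h+1)²`. -/
theorem sum_bump (h : ℕ) : ∑ p ∈ Finset.range (2 * h + 1), bump h p = c0 h * ((h : ℝ) + 1) ^ 2 := by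
  unfold bump
  rw [← Finset.mul_sum, show 2 * h + 1 = (h + 1) + h by ring, Finset.sum_range_add]
  have hA : ∑ p ∈ Finset.range (h + 1), (if p ≤ h then (p : ℝ) + 1 else Lr h - p) =
      ∑ p ∈ Finset.range (h + 1), ((p : ℝ) + 1) :=
    Finset.sum_congr rfl fun p hp => by rw [Finset.mem_range] at hp; rw [if_pos (by omega)]
  have hB : ∑ p ∈ Finset.range h, (if h + 1 + p ≤ h then (((h + 1 + p : ℕ)) : ℝ) + 1 else Lr h - ((h + 1 + p : ℕ) : ℝ)) =
      ∑ p ∈ Finset.range h, ((h : ℝ) - p) :=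
    Finset.sum_congr rfl fun p hp => by rw [if_neg (by omega)]; unfold Lr; push_cast; ring
  rw [hA, hB, Finset.sum_add_distrib, Finset.sum_sub_distrib, Finset.sum_const, Finset.card_range, Finset.sum_const,
    Finset.card_range]
  have g1 := Finset.sum_range_id_mul_two (h + 1)
  have g2 := Finset.sum_range_id_mul_two h
  have e1 : (∑ p ∈ Finset.range (h + 1), (p : ℝ)) = (h : ℝ) * ((h : ℝ) + 1) / 2 := by
    have : ((∑ i ∈ Finset.range (h + 1), i : ℕ) : ℝ) * 2 = ((h + 1 : ℕ) : ℝ) * ((h + 1 - 1 : ℕ) : ℝ) := by exact_mod_cast g1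
    push_cast [Nat.add_sub_cancel] at this; linarith
  have e2 : (∑ p ∈ Finset.range h, (p : ℝ)) = (h : ℝ) * ((h : ℝ) - 1) / 2 := by
    rcases Nat.eq_zero_or_pos h with rfl | hpos
    · simp
    · have : ((∑ i ∈ Finset.range h, i : ℕ) : ℝ) * 2 = ((h : ℕ) : ℝ) * ((h - 1 : ℕ) : ℝ) := by exact_mod_cast g2
      push_cast [Nat.cast_sub hpos] at this; linarith
  rw [e1, e2]; ring

/-- **NEUTRALITY OF THE HOMOTOPY, component `j = −1`**: `Σ_{p ≤ 2h} h₋(p) = 0`. -/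
theorem sum_hm (h : ℕ) : ∑ p ∈ Finset.range (2 * h + 1), hm h p = 0 := by
  unfold hm
  rw [Finset.sum_add_distrib, ← Finset.mul_sum, sum_bump]
  have hA : ∑ p ∈ Finset.range (2 * h + 1), (if p < h then ((p : ℝ) - h) / Lr h else 0) =
      ∑ p ∈ Finset.range h, (((p : ℝ) - h) / Lr h) := by
    rw [show 2 * h + 1 = h + (h + 1) by ring, Finset.sum_range_add]
    have e1 : ∑ p ∈ Finset.range h, (if p < h then ((p : ℝ) - h) / Lr h else 0) = ∑ p ∈ Finset.range h, (((p : ℝ) - h) / Lr h) :=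
      Finset.sum_congr rfl fun p hp => by rw [Finset.mem_range] at hp; rw [if_pos hp]
    have e2 : ∑ p ∈ Finset.range (h + 1), (if h + p < h then (((h + p : ℕ) : ℝ) - h) / Lr h else 0) = 0 :=
      Finset.sum_eq_zero fun p _ => by rw [if_neg (by omega)]
    rw [e1, e2, add_zero]
  rw [hA, ← Finset.sum_div, Finset.sum_sub_distrib, Finset.sum_const, Finset.card_range]
  have g2 := Finset.sum_range_id_mul_two h
  have e2 : (∑ p ∈ Finset.range h, (p : ℝ)) = (h : ℝ) * ((h : ℝ) - 1) / 2 := by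
    rcases Nat.eq_zero_or_pos h with rfl | hpos
    · simp
    · have : ((∑ i ∈ Finset.range h, i : ℕ) : ℝ) * 2 = ((h : ℕ) : ℝ) * ((h - 1 : ℕ) : ℝ) := by exact_mod_cast g2
      push_cast [Nat.cast_sub hpos] at this; linarith
  rw [e2]; unfold eps c0
  have hL := Lr_ne h; have h1 : ((h : ℝ) + 1) ≠ 0 := by positivity
  field_simp; ring

/-- **NEUTRALITY OF THE HOMOTOPY, component `j = 0`**: `Σ_{p ≤ 2h} h₀(p) = 0`. -/
theorem sum_hz (h : ℕ) : ∑ p ∈ Finset.range (2 * h + 1), hz h p = 0 := by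
  unfold hz
  rw [Finset.sum_sub_distrib, ← Finset.mul_sum, sum_bump]
  have hA : ∑ p ∈ Finset.range (2 * h + 1), (if h < p then ((p : ℝ) - h) / Lr h else 0) =
      ∑ p ∈ Finset.range h, (((p : ℝ) + 1) / Lr h) := by
    rw [show 2 * h + 1 = (h + 1) + h by ring, Finset.sum_range_add]
    have e1 : ∑ p ∈ Finset.range (h + 1), (if h < p then ((p : ℝ) - h) / Lr h else 0) = 0 :=
      Finset.sum_eq_zero fun p hp => by rw [Finset.mem_range] at hp; rw [if_neg (by omega)]
    have e2 : ∑ p ∈ Finset.range h, (if h < h + 1 + p then (((h + 1 + p : ℕ) : ℝ) - h) / Lr h else 0) =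
        ∑ p ∈ Finset.range h, (((p : ℝ) + 1) / Lr h) :=
      Finset.sum_congr rfl fun p _ => by rw [if_pos (by omega)]; push_cast; ring
    rw [e1, e2, zero_add]
  rw [hA, ← Finset.sum_div, Finset.sum_add_distrib, Finset.sum_const, Finset.card_range]
  have g2 := Finset.sum_range_id_mul_two h
  have e2 : (∑ p ∈ Finset.range h, (p : ℝ)) = (h : ℝ) * ((h : ℝ) - 1) / 2 := by
    rcases Nat.eq_zero_or_pos h with rfl | hpos
    · simp
    · have : ((∑ i ∈ Finset.range h, i : ℕ) : ℝ) * 2 = ((h : ℕ) : ℝ) * ((h - 1 : ℕ) : ℝ) := by exact_mod_cast g2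
      push_cast [Nat.cast_sub hpos] at this; linarith
  rw [e2]; unfold eps c0
  have hL := Lr_ne h; have h1 : ((h : ℝ) + 1) ≠ 0 := by positivity
  field_simp; ring

/-- **`Σ_{p ≤ 2h} h(p, j) = 0` for every `j`** (`S₀h = 0`). -/
theorem sum_hh (h : ℕ) (j : ℤ) : ∑ p ∈ Finset.range (2 * h + 1), hh h p j = 0 := by
  unfold hh mk3
  split_ifs
  · exact sum_hm h
  · exact sum_hz h
  · exact Finset.sum_const_zero
  · exact Finset.sum_const_zero

/-- `‖P⁰‖, ‖P¹‖ ≤ 1` componentwise. -/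
theorem abs_P0 (h p : ℕ) (j : ℤ) : |P0 h p j| ≤ (if j = 0 then 1 else 0) := by
  unfold P0 mk3 P0z; split_ifs <;> simp
/-- `‖P¹‖ ≤ 1` componentwise. -/
theorem abs_P1 (h p : ℕ) (j : ℤ) : |P1 h p j| ≤ (if j = 0 then 1 else 0) := by
  unfold P1 mk3 P1z; split_ifs <;> simp

/-- `|h₋(p)| + |h₀(p)| ≤ 1` (`p ≤ 2h`). -/
theorem abs_hh (hp : p ≤ 2 * h) : |hm h p| + |hz h p| ≤ 1 := by
  have hL := Lr_pos h
  have hb := eps_bump_le' hp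
  have hb0 := (eps_bump_le (h := h) hp).1
  have hph : |((p : ℝ) - h)| ≤ h := by
    rw [abs_le]; constructor
    · have : (0:ℝ) ≤ p := by positivity
      linarith
    · have : (p : ℝ) ≤ 2 * h := by exact_mod_cast hp
      linarith
  have hq : |((p : ℝ) - h) / Lr h| ≤ (h : ℝ) / Lr h := by rw [abs_div, abs_of_pos hL]; gcongr
  have hq2 : (h : ℝ) / Lr h + 2 * ((h : ℝ) / (2 * Lr h)) ≤ 1 := by
    rw [show (h : ℝ) / Lr h + 2 * ((h : ℝ) / (2 * Lr h)) = (2 * h) / Lr h by field_simp; ring, div_le_one hL]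
    unfold Lr; linarith
  unfold hm hz
  by_cases c : p < h
  · have c2 : ¬ (h < p) := by omega
    simp only [c, c2, if_true, if_false, zero_sub, abs_neg]
    calc _ ≤ (|((p : ℝ) - h) / Lr h| + |eps h * bump h p|) + |eps h * bump h p| := by gcongr; exact abs_add_le _ _
      _ ≤ (h : ℝ) / Lr h + 2 * ((h : ℝ) / (2 * Lr h)) := by rw [abs_of_nonneg hb0]; linarith
      _ ≤ 1 := hq2
  · simp only [c, if_false, zero_add]
    by_cases c2 : h < p
    · simp only [c2, if_true]
      calc _ ≤ |eps h * bump h p| + (|((p : ℝ) - h) / Lr h| + |eps h * bump h p|) := by gcongr; exact abs_sub _ _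
        _ ≤ (h : ℝ) / Lr h + 2 * ((h : ℝ) / (2 * Lr h)) := by rw [abs_of_nonneg hb0]; linarith
        _ ≤ 1 := hq2
    · simp only [c2, if_false, zero_sub, abs_neg, abs_of_nonneg hb0]
      have : (0:ℝ) ≤ (h : ℝ) / Lr h := by positivity
      linarith

/-- `|J⁰₋(p)| + |J⁰₀(p)| + |J⁰₊(p)| ≤ 2` (`p ≤ 2h`). -/
theorem abs_J0 (hp : p ≤ 2 * h) : |J0m h p| + |J0z h p| + |J0p h p| ≤ 2 := by
  have hL := Lr_pos h
  have hb := eps_bump_le' hp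
  have hb0 := (eps_bump_le (h := h) hp).1
  have hhl : (h : ℝ) / Lr h ≤ 1 / 2 := by rw [div_le_div_iff₀ hL (by norm_num)]; unfold Lr; nlinarith
  have hq2 : 4 * ((h : ℝ) / (2 * Lr h)) ≤ 1 := by
    rw [show 4 * ((h : ℝ) / (2 * Lr h)) = 2 * ((h : ℝ) / Lr h) by field_simp; ring]; linarith
  unfold J0m J0z J0p
  by_cases c : p < h
  · have c2 : ¬ (h ≤ p) := by omega
    have hc' : (p : ℝ) + 1 ≤ h := by exact_mod_cast c
    have hp0 : (0 : ℝ) ≤ p := by positivity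
    have hx0 : (0 : ℝ) ≤ ((h : ℝ) - p) / Lr h := div_nonneg (by linarith) hL.le
    have hx1 : ((h : ℝ) - p) / Lr h ≤ (h : ℝ) / Lr h := div_le_div_of_nonneg_right (by linarith) hL.le
    simp only [c, c2, if_true, if_false, zero_sub, abs_neg, abs_of_nonneg hb0]
    have e1 : |((h : ℝ) - p) / Lr h - eps h * bump h p| ≤ ((h : ℝ) - p) / Lr h + eps h * bump h p := by
      rw [abs_le]; constructor <;> linarith
    have e2 : |1 + ((p : ℝ) - h) / Lr h + 2 * (eps h * bump h p)| = 1 - ((h : ℝ) - p) / Lr h + 2 * (eps h * bump h p) := by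
      rw [abs_of_nonneg] <;> [ring; (rw [show ((p : ℝ) - h) / Lr h = -(((h : ℝ) - p) / Lr h) by ring]; linarith)]
    rw [e2]; linarith
  · have c2 : h ≤ p := by omega
    have hc' : (h : ℝ) ≤ p := by exact_mod_cast c2
    have hp2 : (p : ℝ) ≤ 2 * h := by exact_mod_cast hp
    have hx0 : (0 : ℝ) ≤ ((p : ℝ) - h) / Lr h := div_nonneg (by linarith) hL.le
    have hx1 : ((p : ℝ) - h) / Lr h ≤ (h : ℝ) / Lr h := div_le_div_of_nonneg_right (by linarith) hL.le
    simp only [c, c2, if_true, if_false, zero_sub, abs_neg, abs_of_nonneg hb0]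
    have e1 : |((p : ℝ) - h) / Lr h - eps h * bump h p| ≤ ((p : ℝ) - h) / Lr h + eps h * bump h p := by
      rw [abs_le]; constructor <;> linarith
    have e2 : |1 - ((p : ℝ) - h) / Lr h + 2 * (eps h * bump h p)| = 1 - ((p : ℝ) - h) / Lr h + 2 * (eps h * bump h p) :=
      abs_of_nonneg (by linarith)
    rw [e2]; linarith

/-- `|J¹₋(p)| + |J¹₀(p)| + |J¹₊(p)| ≤ 3/L` (`p ≤ 2h`). -/
theorem abs_J1 (p : ℕ) : |J1m h p| + |J1z h p| + |J1p h p| ≤ 3 / Lr h := by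
  have hL := Lr_pos h
  have hc : 0 ≤ eps h * c0 h := mul_nonneg (eps_nonneg h) (c0_pos h).le
  have hc1 := eps_mul_c0_le h
  have hL1 : (0 : ℝ) < 1 / Lr h := by positivity
  have e : 1 / (2 * Lr h) = (1 / Lr h) / 2 := by field_simp
  rw [e] at hc1
  unfold J1m J1z J1p
  by_cases c : p < h
  · have c2 : ¬ (p = 2 * h) := by omega
    simp only [c, c2, if_true, if_false, abs_neg, abs_zero, add_zero, abs_of_nonneg hc]
    rw [abs_of_nonneg (by positivity)]
    have : 3 / Lr h = 3 * (1 / Lr h) := by ring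
    linarith
  · simp only [c, if_false, abs_neg, abs_of_nonneg hc]
    by_cases c2 : p = 2 * h
    · simp only [c2, if_true, abs_neg, abs_of_nonneg hc]
      rw [abs_of_nonneg (by positivity)]
      have : 3 / Lr h = 3 * (1 / Lr h) := by ring
      linarith
    · simp only [c2, if_false, abs_zero, add_zero]
      rw [abs_of_nonneg (by positivity)]
      have : 3 / Lr h = 3 * (1 / Lr h) := by ring
      linarith

end Bounds

end Summit.QuantumFields.YangMills.Theorems.ApproxLift.AnsatzT

end
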